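import Summits.Ventures.YMGap.RobustBall.UniformMassGapZdG
import Summits.Ventures.YMGap.RobustBall.LoopSourceScreening
import Literature.Probability.LatticeModels.GibbsMeasuresLocalTilt
import HarnessLib

/-!
# Venture YMGap, track ROBUST-BALL (Y2) — LOCAL SOURCES CREATE NO PHASES: the DLR states of `W + V` are EXACTLY the
# tilts `e^{−H^V} μ / μ(e^{−H^V})` of the DLR states of `W`, for every bounded source `V` with finitely many terms

HONEST FRAMING. WHAT THIS IS: a venture file (cell `pub-ymgap`, track Y2 ROBUST-BALL, seat rb-p1, theorems only): the lattice
instance of the Literature theorem `gibbsMeasures_bijOn_tilted` (Föllmer 1988, Ch. I, proof of Thm. (2.13): the conditional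
probabilities of `g dμ`).  For the perturbed lattice Yang–Mills specification `perturbedYM ρ β W supp` of ANY adapted bounded
locally listed link potential `W` (compact second-countable structure group, continuous representation `ρ`, any `β`) and ANY adapted
bounded SOURCE `V` whose listed terms belong to a finite catalogue `T` (`suppV Λ ⊆ T` for all `Λ`; total source energy
`H^V = Σ_{A ∈ T} V_A`):
* `perturbedYM_add_eq_tilted_hamiltonianIn` — the kernel of `W + V` in `Λ` is the kernel of `W` tilted by `−H^V_Λ`;
* `perturbedGibbsMeasures_add_bijOn_tilted` — `μ ↦ μ.tilted (−H^V)` is a BIJECTION from the DLR states of `W` onto the DLR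
  states of `W + V` (listed by `supp ∪ suppV`); `perturbedGibbsMeasures_add_eq_image`;
* `hasUniqueGibbsMeasure_add_iff` — `W + V` has exactly one DLR state iff `W` has: A BOUNDED LOCAL SOURCE OF ANY STRENGTH
  NEITHER CREATES NOR DESTROYS A PHASE; in particular (`hasUniqueGibbsMeasure_add_of_uniformMassGapOnBallZdG`) every member of
  a ball carrying the uniform mass-gap currency keeps a unique DLR state under every such source;
* `eq_tilted_of_mem_perturbedGibbsMeasures_add` — if `W` has at most one DLR state `μ`, EVERY DLR state of `W + V` IS
  `μ.tilted (−H^V)`, whence the EXACT RESPONSE FORMULAE `integral_eq_div_of_mem_perturbedGibbsMeasures_add`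
  (`∫ F dν = μ(e^{−H^V} F)/μ(e^{−H^V})`) and `integral_sub_integral_eq_cov_div`
  (`∫ F dν − ∫ F dμ = cov_μ(e^{−H^V}, F)/μ(e^{−H^V})`: the response to a local source is a covariance of the UNPERTURBED state —
  the infinite-volume fluctuation–response identity, exact and non-perturbative in the source).
* ONE WILSON LOOP OF ANY STRENGTH (`hasUniqueGibbsMeasure_add_singleLoop_of_uniformMassGapOnBallZdG`,
  `su2_wilson_singleLoop_hasUniqueGibbsMeasure_upTo_oneThird`): on such a ball — in particular for the `SU(2)` Wilson action on
  `ℤ⁴` at every `0 ≤ β_W ≤ 1/3` — the action plus `t · Re tr U_w/N` for ANY closed walk `w` and ANY real `t` has exactly one DLR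
  state, the tilt of the unperturbed one by `e^{−t Re tr U_w/N}`.
Consequence for the screening / linear-response files of this seat (`LocalSourceScreeningStar*.lean`, `LinearResponseOnBallG.lean`):
their «every DLR state `ν` of `W + V`» is ONE explicit state.  WHAT THIS IS NOT: nothing about sources with infinitely many terms
(e.g. a changed coupling on all of `ℤ^d` — that IS a different phase diagram), no decay estimate (those are the screening files);
lattice only, nothing about the continuum limit or a Clay-sense mass gap.
-/

noncomputable section

open MeasureTheory Function Finset Real
open Literature.Probability.LatticeModels
open Literature.MathematicalPhysics.QuantumLattice
open Literature.MathematicalPhysics.QuantumFieldTheory hiding ZdEdge Site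

namespace Summit.Ventures.YMGap.RobustBall

variable {d N : ℕ}

section General

variable {G : Type*} [Group G] [TopologicalSpace G] [IsTopologicalGroup G] [CompactSpace G]
  [MeasurableSpace G] [BorelSpace G] [SecondCountableTopology G] [T2Space G] (ρ : G →* Matrix (Fin N) (Fin N) ℂ)

omit [T2Space G] in
/-- **The kernel of `W + V` in `Λ` is the kernel of `W` tilted by `−H^V_Λ`** (the two energies differ by the source
Hamiltonian; Mathlib `tilted_tilted`; same statement as `WindowTiltDefect.perturbedYM_add_eq_tilted`, here with the
adaptedness hypothesis of the specification theorem). -/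
theorem perturbedYM_add_eq_tilted_hamiltonianIn (hρ : Continuous ρ) (β : ℝ) {W V : Potential (ZdEdge d) G}
    {supp suppV : Finset (ZdEdge d) → Finset (Finset (ZdEdge d))} (hsupp : W.IsSupportedBy supp)
    (hsuppV : V.IsSupportedBy suppV) (hW : W.IsAdapted) (hWb : ∀ X, ∃ C, ∀ U, |W X U| ≤ C)
    (Λ : Finset (ZdEdge d)) (η : LGConfig d G) :
    perturbedYM ρ β (W + V) (fun Λ => supp Λ ∪ suppV Λ) Λ η =
      (perturbedYM ρ β W supp Λ η).tilted fun U => -hamiltonianIn V suppV Λ U := by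
  classical
  have hE : perturbedEnergy ρ β (W + V) (fun Λ => supp Λ ∪ suppV Λ) Λ =
      perturbedEnergy ρ β W supp Λ + fun U => -hamiltonianIn V suppV Λ U := by
    funext U
    simp only [perturbedEnergy, Pi.add_apply]
    rw [hamiltonianIn_add_apply, hamiltonianIn_eq_of_subfamily hsupp (fun Λ => Finset.subset_union_left) Λ,
      hamiltonianIn_eq_of_subfamily hsuppV (supp' := fun Λ => supp Λ ∪ suppV Λ)
        (fun Λ => Finset.subset_union_right) Λ]
    ring
  unfold perturbedYM
  rw [hE]
  haveI : IsProbabilityMeasure ((Measure.pi fun _ : ↥Λ => haarProbability G).map (glueWith Λ · η)) :=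
    Measure.isProbabilityMeasure_map (measurable_glueWith Λ η).aemeasurable
  obtain ⟨C, hC⟩ := exists_abs_perturbedEnergy_le ρ hρ β hWb supp Λ
  have hint : Integrable (fun U => Real.exp (perturbedEnergy ρ β W supp Λ U))
      ((Measure.pi fun _ : ↥Λ => haarProbability G).map (glueWith Λ · η)) :=
    Integrable.of_bound ((measurable_perturbedEnergy ρ hρ β (fun X => (hW X).2) supp Λ).exp).aestronglyMeasurable
      (Real.exp C) (ae_of_all _ fun U => by
        rw [Real.norm_eq_abs, abs_of_pos (Real.exp_pos _)]
        exact Real.exp_le_exp.2 (abs_le.1 (hC U)).2)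
  exact (tilted_tilted hint _).symm

omit [Group G] [TopologicalSpace G] [IsTopologicalGroup G] [CompactSpace G] [BorelSpace G] [SecondCountableTopology G]
  [T2Space G] in
/-- A finite sum of adapted terms all of which avoid `Λ` does not depend on the links of `Λ`. -/
private theorem dependsOn_sum_compl {V : Potential (ZdEdge d) G} (hV : V.IsAdapted) (Λ : Finset (ZdEdge d))
    (s : Finset (Finset (ZdEdge d))) (hs : ∀ A ∈ s, ¬(A ∩ Λ).Nonempty) :
    DependsOn (fun U => ∑ A ∈ s, V A U) ((↑Λ : Set (ZdEdge d))ᶜ) := by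
  intro U U' h
  refine Finset.sum_congr rfl fun A hA => (hV A).1 fun x hx => h x ?_
  intro hxΛ
  exact hs A hA ⟨x, Finset.mem_inter.2 ⟨Finset.mem_coe.1 hx, Finset.mem_coe.1 hxΛ⟩⟩

/-- **THE DLR STATES OF `W + V` ARE THE TILTS OF THE DLR STATES OF `W` — A BIJECTION.** For a continuous representation `ρ`
of a compact second-countable group, any `β`, an adapted bounded potential `W` listed by `supp`, and an adapted bounded source
`V` listed by `suppV` inside a finite catalogue `T` (`suppV Λ ⊆ T`), the map `μ ↦ μ.tilted (−Σ_{A ∈ T} V_A)` is a bijection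
`𝒢(W) → 𝒢(W + V)` (Literature `gibbsMeasures_bijOn_tilted`, Föllmer 1988 Ch. I (2.13)). -/
theorem perturbedGibbsMeasures_add_bijOn_tilted (hρ : Continuous ρ) (β : ℝ)
    {W : Potential (ZdEdge d) G} (hW : W.IsAdapted) (hWb : ∀ X, ∃ C, ∀ U, |W X U| ≤ C)
    {supp : Finset (ZdEdge d) → Finset (Finset (ZdEdge d))} (hsupp : W.IsSupportedBy supp)
    {V : Potential (ZdEdge d) G} (hV : V.IsAdapted) (hVb : ∀ X, ∃ C, ∀ U, |V X U| ≤ C)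
    {suppV : Finset (ZdEdge d) → Finset (Finset (ZdEdge d))} (hsuppV : V.IsSupportedBy suppV)
    {T : Finset (Finset (ZdEdge d))} (hT : ∀ Λ, suppV Λ ⊆ T) :
    Set.BijOn (fun μ : Measure (LGConfig d G) => μ.tilted fun U => -∑ A ∈ T, V A U)
      (perturbedGibbsMeasures ρ β W supp) (perturbedGibbsMeasures ρ β (W + V) (fun Λ => supp Λ ∪ suppV Λ)) := by
  classical
  have hWV : (W + V).IsAdapted := isAdapted_add hW hV
  have hWVb : ∀ X, ∃ C, ∀ U, |(W + V) X U| ≤ C := fun X => by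
    obtain ⟨C₁, h₁⟩ := hWb X; obtain ⟨C₂, h₂⟩ := hVb X
    exact ⟨C₁ + C₂, fun U => (abs_add_le _ _).trans (add_le_add (h₁ U) (h₂ U))⟩
  have hγ : IsSpecification (perturbedYM (d := d) ρ β W supp) := isSpecification_perturbedYM ρ hρ β hW hWb hsupp
  have hγ' : IsSpecification (perturbedYM (d := d) ρ β (W + V) (fun Λ => supp Λ ∪ suppV Λ)) :=
    isSpecification_perturbedYM ρ hρ β hWV hWVb (isSupportedBy_add_union hsupp hsuppV)
  -- bounds for the source terms
  choose C hC using hVb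
  have hflocm : ∀ Λ : Finset (ZdEdge d), Measurable fun U : LGConfig d G => -hamiltonianIn V suppV Λ U :=
    fun Λ => (measurable_hamiltonianIn (fun A => (hV A).2) suppV Λ).neg
  have hflocb : ∀ Λ : Finset (ZdEdge d), ∃ B, ∀ U : LGConfig d G, |(-hamiltonianIn V suppV Λ U)| ≤ B :=
    fun Λ => ⟨_, fun U => by rw [abs_neg]; exact abs_hamiltonianIn_le (fun A U => hC A U) suppV Λ U⟩
  have hfm : Measurable fun U : LGConfig d G => -∑ A ∈ T, V A U :=
    (Finset.measurable_sum _ fun A _ => (hV A).2).neg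
  have hfb : ∀ U : LGConfig d G, |(-∑ A ∈ T, V A U)| ≤ ∑ A ∈ T, C A := fun U => by
    rw [abs_neg]; exact (Finset.abs_sum_le_sum_abs _ _).trans (Finset.sum_le_sum fun A _ => hC A U)
  have hdiff : ∀ Λ : Finset (ZdEdge d), DependsOn (fun U : LGConfig d G =>
      (-∑ A ∈ T, V A U) - (-hamiltonianIn V suppV Λ U)) ((↑Λ : Set (ZdEdge d))ᶜ) := by
    intro Λ
    have hsplit : ∀ U, (-∑ A ∈ T, V A U) - (-hamiltonianIn V suppV Λ U) =
        -∑ A ∈ T with ¬(A ∩ Λ).Nonempty, V A U := by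
      intro U
      rw [hamiltonianIn_eq_sum_filter_of_subset hsuppV (hT Λ) U,
        ← Finset.sum_filter_add_sum_filter_not T (fun A => (A ∩ Λ).Nonempty) (fun A => V A U)]
      ring
    have hdep := dependsOn_sum_compl hV Λ (T.filter fun A => ¬(A ∩ Λ).Nonempty)
      (fun A hA => (Finset.mem_filter.1 hA).2)
    intro U U' h
    have key := hdep h
    simp only at key
    simp only [hsplit, key]
  exact gibbsMeasures_bijOn_tilted hγ hγ' hflocm hflocb hfm hfb hdiff
    (fun Λ η => perturbedYM_add_eq_tilted_hamiltonianIn ρ hρ β hsupp hsuppV hW hWb Λ η)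

/-- **The DLR states of `W + V` as a set**: the image of `𝒢(W)` under the tilt. -/
theorem perturbedGibbsMeasures_add_eq_image (hρ : Continuous ρ) (β : ℝ)
    {W : Potential (ZdEdge d) G} (hW : W.IsAdapted) (hWb : ∀ X, ∃ C, ∀ U, |W X U| ≤ C)
    {supp : Finset (ZdEdge d) → Finset (Finset (ZdEdge d))} (hsupp : W.IsSupportedBy supp)
    {V : Potential (ZdEdge d) G} (hV : V.IsAdapted) (hVb : ∀ X, ∃ C, ∀ U, |V X U| ≤ C)
    {suppV : Finset (ZdEdge d) → Finset (Finset (ZdEdge d))} (hsuppV : V.IsSupportedBy suppV)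
    {T : Finset (Finset (ZdEdge d))} (hT : ∀ Λ, suppV Λ ⊆ T) :
    perturbedGibbsMeasures ρ β (W + V) (fun Λ => supp Λ ∪ suppV Λ) =
      (fun μ : Measure (LGConfig d G) => μ.tilted fun U => -∑ A ∈ T, V A U) '' perturbedGibbsMeasures ρ β W supp :=
  (perturbedGibbsMeasures_add_bijOn_tilted ρ hρ β hW hWb hsupp hV hVb hsuppV hT).image_eq.symm

/-- **A BOUNDED LOCAL SOURCE NEITHER CREATES NOR DESTROYS A PHASE**: `W + V` has exactly one DLR state iff `W` has. -/
theorem hasUniqueGibbsMeasure_add_iff (hρ : Continuous ρ) (β : ℝ)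
    {W : Potential (ZdEdge d) G} (hW : W.IsAdapted) (hWb : ∀ X, ∃ C, ∀ U, |W X U| ≤ C)
    {supp : Finset (ZdEdge d) → Finset (Finset (ZdEdge d))} (hsupp : W.IsSupportedBy supp)
    {V : Potential (ZdEdge d) G} (hV : V.IsAdapted) (hVb : ∀ X, ∃ C, ∀ U, |V X U| ≤ C)
    {suppV : Finset (ZdEdge d) → Finset (Finset (ZdEdge d))} (hsuppV : V.IsSupportedBy suppV)
    {T : Finset (Finset (ZdEdge d))} (hT : ∀ Λ, suppV Λ ⊆ T) :
    HasUniqueGibbsMeasure (perturbedYM (d := d) ρ β (W + V) (fun Λ => supp Λ ∪ suppV Λ)) ↔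
      HasUniqueGibbsMeasure (perturbedYM (d := d) ρ β W supp) := by
  have hbij := perturbedGibbsMeasures_add_bijOn_tilted ρ hρ β hW hWb hsupp hV hVb hsuppV hT
  unfold HasUniqueGibbsMeasure
  change (perturbedGibbsMeasures ρ β (W + V) (fun Λ => supp Λ ∪ suppV Λ)).Subsingleton ∧
      (perturbedGibbsMeasures ρ β (W + V) (fun Λ => supp Λ ∪ suppV Λ)).Nonempty ↔
    (perturbedGibbsMeasures ρ β W supp).Subsingleton ∧ (perturbedGibbsMeasures ρ β W supp).Nonempty
  rw [← hbij.image_eq]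
  constructor
  · rintro ⟨hs, hn⟩
    exact ⟨fun μ₁ h₁ μ₂ h₂ => hbij.injOn h₁ h₂ (hs ⟨μ₁, h₁, rfl⟩ ⟨μ₂, h₂, rfl⟩), (Set.image_nonempty.1 hn)⟩
  · rintro ⟨hs, hn⟩
    exact ⟨hs.image _, hn.image _⟩

/-- **THE PERTURBED STATE IS THE TILT**: if `W` has at most one DLR state and `μ` is one, then EVERY DLR state `ν` of `W + V`
is `μ.tilted (−Σ_{A ∈ T} V_A)`. -/
theorem eq_tilted_of_mem_perturbedGibbsMeasures_add (hρ : Continuous ρ) (β : ℝ)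
    {W : Potential (ZdEdge d) G} (hW : W.IsAdapted) (hWb : ∀ X, ∃ C, ∀ U, |W X U| ≤ C)
    {supp : Finset (ZdEdge d) → Finset (Finset (ZdEdge d))} (hsupp : W.IsSupportedBy supp)
    {V : Potential (ZdEdge d) G} (hV : V.IsAdapted) (hVb : ∀ X, ∃ C, ∀ U, |V X U| ≤ C)
    {suppV : Finset (ZdEdge d) → Finset (Finset (ZdEdge d))} (hsuppV : V.IsSupportedBy suppV)
    {T : Finset (Finset (ZdEdge d))} (hT : ∀ Λ, suppV Λ ⊆ T)
    (huniq : (perturbedGibbsMeasures ρ β W supp).Subsingleton)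
    {μ ν : Measure (LGConfig d G)} (hμ : μ ∈ perturbedGibbsMeasures ρ β W supp)
    (hν : ν ∈ perturbedGibbsMeasures ρ β (W + V) (fun Λ => supp Λ ∪ suppV Λ)) :
    ν = μ.tilted fun U => -∑ A ∈ T, V A U := by
  have hbij := perturbedGibbsMeasures_add_bijOn_tilted ρ hρ β hW hWb hsupp hV hVb hsuppV hT
  obtain ⟨μ', hμ', rfl⟩ := hbij.surjOn hν
  simp only [huniq hμ' hμ]

/-- **EXPECTATIONS IN THE PERTURBED STATE**: under the hypotheses of `eq_tilted_of_mem_perturbedGibbsMeasures_add`, for every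
`F`, `∫ F dν = (∫ e^{−H^V} F dμ)/(∫ e^{−H^V} dμ)` (`H^V = Σ_{A ∈ T} V_A`). -/
theorem integral_eq_div_of_mem_perturbedGibbsMeasures_add (hρ : Continuous ρ) (β : ℝ)
    {W : Potential (ZdEdge d) G} (hW : W.IsAdapted) (hWb : ∀ X, ∃ C, ∀ U, |W X U| ≤ C)
    {supp : Finset (ZdEdge d) → Finset (Finset (ZdEdge d))} (hsupp : W.IsSupportedBy supp)
    {V : Potential (ZdEdge d) G} (hV : V.IsAdapted) (hVb : ∀ X, ∃ C, ∀ U, |V X U| ≤ C)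
    {suppV : Finset (ZdEdge d) → Finset (Finset (ZdEdge d))} (hsuppV : V.IsSupportedBy suppV)
    {T : Finset (Finset (ZdEdge d))} (hT : ∀ Λ, suppV Λ ⊆ T)
    (huniq : (perturbedGibbsMeasures ρ β W supp).Subsingleton)
    {μ ν : Measure (LGConfig d G)} (hμ : μ ∈ perturbedGibbsMeasures ρ β W supp)
    (hν : ν ∈ perturbedGibbsMeasures ρ β (W + V) (fun Λ => supp Λ ∪ suppV Λ)) (F : LGConfig d G → ℝ) :
    ∫ U, F U ∂ν = (∫ U, Real.exp (-∑ A ∈ T, V A U) * F U ∂μ) / ∫ U, Real.exp (-∑ A ∈ T, V A U) ∂μ := by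
  rw [eq_tilted_of_mem_perturbedGibbsMeasures_add ρ hρ β hW hWb hsupp hV hVb hsuppV hT huniq hμ hν, integral_tilted,
    ← integral_div]
  refine integral_congr_ae (ae_of_all _ fun U => ?_)
  simp only [smul_eq_mul]
  ring

/-- **RESPONSE = COVARIANCE (the infinite-volume fluctuation–response identity, exact in the source)**: under the same
hypotheses, for every bounded measurable `F`,
`∫ F dν − ∫ F dμ = cov_μ(e^{−H^V}, F)/μ(e^{−H^V})`, `cov_μ(g, F) = ∫ g F dμ − ∫ g dμ ∫ F dμ`. -/
theorem integral_sub_integral_eq_cov_div (hρ : Continuous ρ) (β : ℝ)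
    {W : Potential (ZdEdge d) G} (hW : W.IsAdapted) (hWb : ∀ X, ∃ C, ∀ U, |W X U| ≤ C)
    {supp : Finset (ZdEdge d) → Finset (Finset (ZdEdge d))} (hsupp : W.IsSupportedBy supp)
    {V : Potential (ZdEdge d) G} (hV : V.IsAdapted) (hVb : ∀ X, ∃ C, ∀ U, |V X U| ≤ C)
    {suppV : Finset (ZdEdge d) → Finset (Finset (ZdEdge d))} (hsuppV : V.IsSupportedBy suppV)
    {T : Finset (Finset (ZdEdge d))} (hT : ∀ Λ, suppV Λ ⊆ T)
    (huniq : (perturbedGibbsMeasures ρ β W supp).Subsingleton)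
    {μ ν : Measure (LGConfig d G)} (hμ : μ ∈ perturbedGibbsMeasures ρ β W supp)
    (hν : ν ∈ perturbedGibbsMeasures ρ β (W + V) (fun Λ => supp Λ ∪ suppV Λ)) (F : LGConfig d G → ℝ) :
    (∫ U, F U ∂ν) - ∫ U, F U ∂μ =
      ((∫ U, Real.exp (-∑ A ∈ T, V A U) * F U ∂μ) -
        (∫ U, Real.exp (-∑ A ∈ T, V A U) ∂μ) * ∫ U, F U ∂μ) / ∫ U, Real.exp (-∑ A ∈ T, V A U) ∂μ := by
  haveI := (show IsGibbsMeasure _ μ from hμ).isProbabilityMeasure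
  have hZ : 0 < ∫ U, Real.exp (-∑ A ∈ T, V A U) ∂μ := by
    choose C hC using hVb
    refine integral_exp_pos (Integrable.of_bound ?_ (Real.exp (∑ A ∈ T, C A)) (ae_of_all _ fun U => ?_))
    · exact (Finset.measurable_sum _ fun A _ => (hV A).2).neg.exp.aestronglyMeasurable
    · rw [Real.norm_eq_abs, abs_of_pos (Real.exp_pos _)]
      refine Real.exp_le_exp.2 ?_
      have := (Finset.abs_sum_le_sum_abs (fun A => V A U) T).trans (Finset.sum_le_sum fun A _ => hC A U)
      linarith [(abs_le.1 this).1]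
  rw [integral_eq_div_of_mem_perturbedGibbsMeasures_add ρ hρ β hW hWb hsupp hV hVb hsuppV hT huniq hμ hν F]
  field_simp

end General

/-! ### The gauge-invariant ball: every member keeps ONE state under every bounded local source -/

section Ball

/-- **ON A BALL CARRYING THE UNIFORM MASS-GAP CURRENCY, LOCAL SOURCES CREATE NO PHASES**: if
`UniformMassGapOnBallZdG d N β ε₀ ε₁ R m A` holds, then for every member `(W, supp)` of `MemBallZdG ε₀ ε₁ R` and every adapted bounded
source `V` with finitely many listed terms, `W + V` has EXACTLY ONE DLR state — the tilt of the member's state by `e^{−H^V}`. -/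
theorem hasUniqueGibbsMeasure_add_of_uniformMassGapOnBallZdG {β ε₀ ε₁ m A : ℝ} {R : ℕ}
    (h : UniformMassGapOnBallZdG d N β ε₀ ε₁ R m A)
    {W : Potential (ZdEdge d) (SUN N)} {supp : Finset (ZdEdge d) → Finset (Finset (ZdEdge d))}
    (hW : MemBallZdG ε₀ ε₁ R W supp)
    {V : Potential (ZdEdge d) (SUN N)} (hV : V.IsAdapted) (hVb : ∀ X, ∃ C, ∀ U, |V X U| ≤ C)
    {suppV : Finset (ZdEdge d) → Finset (Finset (ZdEdge d))} (hsuppV : V.IsSupportedBy suppV)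
    {T : Finset (Finset (ZdEdge d))} (hT : ∀ Λ, suppV Λ ⊆ T) :
    HasUniqueGibbsMeasure (perturbedYM (d := d) (fundamentalRep (Fin N)) (N * β) (W + V) (fun Λ => supp Λ ∪ suppV Λ)) := by
  haveI : SecondCountableTopology (Matrix (Fin N) (Fin N) ℂ) :=
    inferInstanceAs (SecondCountableTopology (Fin N → Fin N → ℂ))
  haveI : SecondCountableTopology (SUN N) := Topology.IsEmbedding.subtypeVal.secondCountableTopology
  have hWa : W.IsAdapted := fun X => ⟨hW.dependsOn X, (hW.continuous X).measurable⟩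
  have hWb : ∀ X, ∃ C, ∀ U, |W X U| ≤ C := fun X => exists_bound_of_continuous (hW.continuous X)
  exact (hasUniqueGibbsMeasure_add_iff (fundamentalRep (Fin N)) (continuous_fundamentalRep (Fin N)) (N * β) hWa hWb
    hW.supportedBy hV hVb hsuppV hT).2 (h.2 W supp hW).1

/-- **AND THE PERTURBED EXPECTATIONS ARE RATIOS OF UNPERTURBED ONES**: on such a ball, for the member's DLR state `μ` and any DLR
state `ν` of `W + V`, `∫ F dν − ∫ F dμ = cov_μ(e^{−H^V}, F)/μ(e^{−H^V})`. -/
theorem integral_sub_integral_eq_cov_div_of_uniformMassGapOnBallZdG {β ε₀ ε₁ m A : ℝ} {R : ℕ}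
    (h : UniformMassGapOnBallZdG d N β ε₀ ε₁ R m A)
    {W : Potential (ZdEdge d) (SUN N)} {supp : Finset (ZdEdge d) → Finset (Finset (ZdEdge d))}
    (hW : MemBallZdG ε₀ ε₁ R W supp)
    {V : Potential (ZdEdge d) (SUN N)} (hV : V.IsAdapted) (hVb : ∀ X, ∃ C, ∀ U, |V X U| ≤ C)
    {suppV : Finset (ZdEdge d) → Finset (Finset (ZdEdge d))} (hsuppV : V.IsSupportedBy suppV)
    {T : Finset (Finset (ZdEdge d))} (hT : ∀ Λ, suppV Λ ⊆ T)
    {μ ν : Measure (LGConfig d (SUN N))}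
    (hμ : μ ∈ perturbedGibbsMeasures (d := d) (fundamentalRep (Fin N)) (N * β) W supp)
    (hν : ν ∈ perturbedGibbsMeasures (d := d) (fundamentalRep (Fin N)) (N * β) (W + V) (fun Λ => supp Λ ∪ suppV Λ))
    (F : LGConfig d (SUN N) → ℝ) :
    (∫ U, F U ∂ν) - ∫ U, F U ∂μ =
      ((∫ U, Real.exp (-∑ A ∈ T, V A U) * F U ∂μ) -
        (∫ U, Real.exp (-∑ A ∈ T, V A U) ∂μ) * ∫ U, F U ∂μ) / ∫ U, Real.exp (-∑ A ∈ T, V A U) ∂μ := by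
  haveI : SecondCountableTopology (Matrix (Fin N) (Fin N) ℂ) :=
    inferInstanceAs (SecondCountableTopology (Fin N → Fin N → ℂ))
  haveI : SecondCountableTopology (SUN N) := Topology.IsEmbedding.subtypeVal.secondCountableTopology
  have hWa : W.IsAdapted := fun X => ⟨hW.dependsOn X, (hW.continuous X).measurable⟩
  have hWb : ∀ X, ∃ C, ∀ U, |W X U| ≤ C := fun X => exists_bound_of_continuous (hW.continuous X)
  exact integral_sub_integral_eq_cov_div (fundamentalRep (Fin N)) (continuous_fundamentalRep (Fin N)) (N * β) hWa hWb
    hW.supportedBy hV hVb hsuppV hT (h.2 W supp hW).1.1 hμ hν F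

/-! ### One Wilson loop of any strength -/

/-- **ONE WILSON LOOP OF ANY STRENGTH CREATES NO PHASE** on a ball carrying the uniform mass-gap currency: for every member
`(W, supp)` of `MemBallZdG ε₀ ε₁ R`, every closed lattice walk `w` and every real `t`, the action `W + t · Re tr(U_w)/N`
(`loopFamilyAction N (fun _ : Unit => ⟨x, w⟩) (fun _ => t)`) has exactly one DLR state. -/
theorem hasUniqueGibbsMeasure_add_singleLoop_of_uniformMassGapOnBallZdG {β ε₀ ε₁ m A : ℝ} {R : ℕ}
    (h : UniformMassGapOnBallZdG d N β ε₀ ε₁ R m A)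
    {W : Potential (ZdEdge d) (SUN N)} {supp : Finset (ZdEdge d) → Finset (Finset (ZdEdge d))}
    (hW : MemBallZdG ε₀ ε₁ R W supp) {x : Site d} (w : (zdGraph d).Walk x x) (t : ℝ) :
    HasUniqueGibbsMeasure (perturbedYM (d := d) (fundamentalRep (Fin N)) (N * β)
      (W + loopFamilyAction N (fun _ : Unit => (⟨x, w⟩ : ZdLoop d)) (fun _ => t))
      (fun Λ => supp Λ ∪ loopSupp (fun _ : Unit => (⟨x, w⟩ : ZdLoop d)) Λ)) := by
  classical
  set γ : Unit → ZdLoop d := fun _ => ⟨x, w⟩ with hγ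
  have hfin : ∀ X, {i | walkEdges (γ i).walk = X}.Finite := fun _ => Set.toFinite _
  have hthr : ∀ e : ZdEdge d, {i | e ∈ walkEdges (γ i).walk}.Finite := fun _ => Set.toFinite _
  have hmemV : MemBallZd (2 * (|t| * w.length)) (|t| * w.length) (2 * w.length) (loopFamilyAction (d := d) N γ fun _ => t)
      (loopSupp γ) :=
    memBallZd_loopFamilyAction hfin hthr (fun _ _ he _ hy => norm_sub_le_two_mul_length_of_mem_walkEdges w he hy)
      (loopNormLE_single w t)
  have hV : (loopFamilyAction (d := d) N γ fun _ => t).IsAdapted := fun X =>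
    ⟨hmemV.dependsOn X, (hmemV.continuous X).measurable⟩
  have hVb : ∀ X, ∃ C, ∀ U, |loopFamilyAction (d := d) N γ (fun _ => t) X U| ≤ C := fun X =>
    exists_bound_of_continuous (hmemV.continuous X)
  have hT : ∀ Λ, loopSupp γ Λ ⊆ Finset.univ.image fun i => walkEdges (γ i).walk := fun Λ =>
    Finset.image_subset_image (Finset.subset_univ _)
  exact hasUniqueGibbsMeasure_add_of_uniformMassGapOnBallZdG h hW hV hVb hmemV.supportedBy hT

/-- **THE `SU(2)` WILSON POINT ON `ℤ⁴`, `0 ≤ β_W ≤ 1/3`: one Wilson loop of ANY strength creates no phase.** For every closed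
walk `w` and every real `t`, lattice `SU(2)` Yang–Mills at `β_W` (tree coupling `β_W/2`) with the loop `t · Re tr(U_w)/2` inserted
into the action has EXACTLY ONE DLR state (the tilt of the unique Wilson DLR state by `e^{−t Re tr U_w/2}`,
`eq_tilted_of_mem_perturbedGibbsMeasures_add`). -/
theorem su2_wilson_singleLoop_hasUniqueGibbsMeasure_upTo_oneThird {βW : ℝ} (h0 : 0 ≤ βW) (h1 : βW ≤ 1 / 3)
    {x : Site 4} (w : (zdGraph 4).Walk x x) (t : ℝ) :
    HasUniqueGibbsMeasure (perturbedYM (d := 4) (fundamentalRep (Fin 2)) (2 * (βW / 4))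
      (loopFamilyAction 2 (fun _ : Unit => (⟨x, w⟩ : ZdLoop 4)) (fun _ => t))
      (loopSupp (fun _ : Unit => (⟨x, w⟩ : ZdLoop 4)))) := by
  obtain ⟨m, -, hball⟩ := su2_uniformStar_upTo_oneThird
  have hmem : MemBallZdG (N := 2) (d := 4) (3 / 125) (3 / 250) 0 0 (fun _ => (∅ : Finset (Finset (ZdEdge 4)))) :=
    memBallZdG_zero (by norm_num) (by norm_num) 0
  have key := hasUniqueGibbsMeasure_add_singleLoop_of_uniformMassGapOnBallZdG (hball βW h0 h1 0) hmem w t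
  simpa only [zero_add, Finset.empty_union, Nat.cast_ofNat] using key

end Ball

end Summit.Ventures.YMGap.RobustBall

end
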